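import Mathlib
import Summits.Ventures.HodgeRepro2.T5CyclotomicSubfieldCM
import Summits.Ventures.HodgeRepro2.T5CyclotomicSubfieldSexticCensus

/-!
# THE SEXTIC GALOIS CM CASE ON A CYCLOTOMIC PRESENTATION, IN ONE STATEMENT

Tier-5 support N2 / N3 / §G-N4.2 (seat p3, gen 81). The brief's «sextic Galois CM case» for a field GIVEN as a
subfield `F ⊆ ℚ(ζₘ)` with `[F : ℚ] = 6` and `−1 ∉ H_F` (every sextic Galois CM field is abelian — file 280 — hence of
this form by Kronecker–Weber, the one printed input left): everything the cell proved about it, read off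
`(ℤ/mℤ)ˣ / H_F`.

* **`sextic_cyclotomic_subfield_structure`**: `F` is a CM field, Galois over `ℚ` with cyclic Galois group, `[F⁺ : ℚ] = 3`;
* **`sextic_cyclotomic_subfield_census`**: for `p ∤ m`, a prime `𝔭 ∣ p` of `F` and the place `v` of `F⁺` under it:
  `f(𝔭/p) = ord(p · H_F)`; `v` stays prime in `F` ⟺ `ord(p · H_F)` even ⟺ `(−1) · H_F ∈ ⟨p · H_F⟩`; in that case
  `2 f(v/p) = ord(p · H_F)` and the record's Satake chain holds at `v` with `q = p^{ord(p · H_F)/2}`;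
* **`sextic_cyclotomic_subfield_infinitude`**: every prime `p ≡ −1 mod m` gives degree-one inert places, every
  `p ≡ 1 mod m` splits completely, and there are infinitely many of each (Dirichlet).

§8(d): uses an L-value-free non-vanishing device: NO.
-/

open NumberField NumberField.IsCMField IsCyclotomicExtension.Rat Ideal IsDedekindDomain
  IsDedekindDomain.HeightOneSpectrum
open Summit.Ventures.HodgeRepro2.T5CyclotomicSubfieldInertiaDeg
  Summit.Ventures.HodgeRepro2.T5CyclotomicSubfieldDecomposition
  Summit.Ventures.HodgeRepro2.T5CyclotomicTwentyOneSatake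
  Summit.Ventures.HodgeRepro2.T5CyclotomicSubfieldSatake
  Summit.Ventures.HodgeRepro2.T5CyclotomicSubfieldInfinitude
  Summit.Ventures.HodgeRepro2.T5CyclotomicSubfieldCM
  Summit.Ventures.HodgeRepro2.T5CyclotomicSubfieldSexticCensus
  Summit.Ventures.HodgeRepro2.T5GlobalLatticeAlmostAll

namespace Summit.Ventures.HodgeRepro2.T5CyclotomicSubfieldSexticSummary

variable (m : ℕ) [NeZero m] (L : Type*) [Field L] [NumberField L] [IsCyclotomicExtension {m} ℚ L] [IsCMField L]
  (F : IntermediateField ℚ L) (h6 : Module.finrank ℚ F = 6) (hF : (-1 : (ZMod m)ˣ) ∉ zmodSubgroup m L F)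

include hF h6 in
/-- **STRUCTURE**: a sextic subfield `F ⊆ ℚ(ζₘ)` with `−1 ∉ H_F` is a CM field, Galois over `ℚ` with cyclic Galois
group, and `[F⁺ : ℚ] = 3`. -/
theorem sextic_cyclotomic_subfield_structure :
    IsCMField F ∧ IsGalois ℚ F ∧ IsCyclic (F ≃ₐ[ℚ] F) ∧
      (haveI := isCMField_of_neg_one_notMem m L F hF; Module.finrank ℚ (maximalRealSubfield F) = 3) := by
  haveI := isCMField_of_neg_one_notMem m L F hF
  haveI := T5CyclotomicUnramified.isGalois_intermediateField L m F
  exact ⟨inferInstance, inferInstance, T5CMFieldCyclicGaloisCriterion.isCyclic_gal F h6,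
    T5CMFieldCyclicGaloisCriterion.finrank_maximalRealSubfield F h6⟩

variable (p : ℕ) [hp : Fact p.Prime] (hpm : p.Coprime m)
  (𝔭 : Ideal (𝓞 F)) [h𝔭 : 𝔭.IsPrime] [h𝔭p : 𝔭.LiesOver (span {(p : ℤ)})]

include hF h6 hpm h𝔭 h𝔭p in
/-- **THE CENSUS AND THE CHAIN**: for `p ∤ m` and a prime `𝔭 ∣ p` of `F`, `f(𝔭/p) = ord(p · H_F)`, and for the place
`v` of `F⁺` under `𝔭`: `v` stays prime in `F` ⟺ `ord(p · H_F)` even ⟺ `(−1) · H_F ∈ ⟨p · H_F⟩`, and then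
`2 f(v/p) = ord(p · H_F)` and the record's Satake chain holds at `v` with `q = p^{ord(p · H_F)/2}` (files 286, 287,
293, 295). -/
theorem sextic_cyclotomic_subfield_census :
    haveI := isCMField_of_neg_one_notMem m L F hF
    𝔭.inertiaDeg ℤ = orderOf (QuotientGroup.mk (ZMod.unitOfCoprime p hpm) : (ZMod m)ˣ ⧸ zmodSubgroup m L F) ∧
    ∀ (v : HeightOneSpectrum (𝓞 (maximalRealSubfield F))) [𝔭.LiesOver v.asIdeal],
      ((∃ w : HeightOneSpectrum (𝓞 F),
          Ideal.map (algebraMap (𝓞 (maximalRealSubfield F)) (𝓞 F)) v.asIdeal = w.asIdeal) ↔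
        Even (orderOf (QuotientGroup.mk (ZMod.unitOfCoprime p hpm) : (ZMod m)ˣ ⧸ zmodSubgroup m L F))) ∧
      ((∃ w : HeightOneSpectrum (𝓞 F),
          Ideal.map (algebraMap (𝓞 (maximalRealSubfield F)) (𝓞 F)) v.asIdeal = w.asIdeal) ↔
        (QuotientGroup.mk (-1) : (ZMod m)ˣ ⧸ zmodSubgroup m L F) ∈
          Subgroup.zpowers (QuotientGroup.mk (ZMod.unitOfCoprime p hpm))) ∧
      ((QuotientGroup.mk (-1) : (ZMod m)ˣ ⧸ zmodSubgroup m L F) ∈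
          Subgroup.zpowers (QuotientGroup.mk (ZMod.unitOfCoprime p hpm)) →
        2 * v.asIdeal.inertiaDeg ℤ =
            orderOf (QuotientGroup.mk (ZMod.unitOfCoprime p hpm) : (ZMod m)ˣ ⧸ zmodSubgroup m L F) ∧
          ∀ {r : ℕ} (l : Fin r → 𝓞 F) (k : Type*) [Field k] [CharZero k],
            Submodule.span (𝓞 (maximalRealSubfield F)) (Set.range l) = ⊤ →
            ∀ {H : Matrix (Fin 3) (Fin 3) F}, H.IsHermitian → IsUnit H.det →
            (∀ w : HeightOneSpectrum (𝓞 F), w.asIdeal.LiesOver v.asIdeal → w ∉ badSet H) →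
            ChainNumerals F v l k H
              (p ^ (orderOf (QuotientGroup.mk (ZMod.unitOfCoprime p hpm) :
                (ZMod m)ˣ ⧸ zmodSubgroup m L F) / 2))
              ((p ^ (orderOf (QuotientGroup.mk (ZMod.unitOfCoprime p hpm) :
                (ZMod m)ˣ ⧸ zmodSubgroup m L F) / 2)) ^ 3 + 1)
              ((p ^ (orderOf (QuotientGroup.mk (ZMod.unitOfCoprime p hpm) :
                (ZMod m)ˣ ⧸ zmodSubgroup m L F) / 2)) ^ 4)
              ((p ^ (orderOf (QuotientGroup.mk (ZMod.unitOfCoprime p hpm) :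
                (ZMod m)ˣ ⧸ zmodSubgroup m L F) / 2)) ^ 4 +
                p ^ (orderOf (QuotientGroup.mk (ZMod.unitOfCoprime p hpm) :
                  (ZMod m)ˣ ⧸ zmodSubgroup m L F) / 2))) := by
  haveI := isCMField_of_neg_one_notMem m L F hF
  haveI := isTotallyComplex_of_neg_one_notMem m L F hF
  refine ⟨inertiaDeg_eq_orderOf_mk m L F p hpm 𝔭, fun v _ => ⟨?_, ?_, fun hmem => ⟨?_, ?_⟩⟩⟩
  · exact exists_map_eq_iff_even_orderOf_mk m L F h6 p hpm 𝔭 v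
  · exact exists_map_eq_iff_mem_zpowers m L F p hpm 𝔭 v
  · exact two_mul_inertiaDeg_eq_orderOf_mk m L F p hpm 𝔭 v hmem
  · intro r l k _ _ hl H hH hdet hbad
    exact chainNumerals_of_mem' m L F p hpm 𝔭 v hmem l k hl hH hdet hbad

include hF in
/-- **INFINITUDE**: every prime `p ≡ −1 mod m` gives degree-one inert places of `F` (`f(𝔭/p) = 2`, `f(v/p) = 1`, `v`
stays prime), every prime `p ≡ 1 mod m` splits completely (two primes of `F` above every place of `F⁺` above `p`),
and there are infinitely many primes of each kind. -/
theorem sextic_cyclotomic_subfield_infinitude :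
    haveI := isCMField_of_neg_one_notMem m L F hF
    (∀ (p : ℕ) [Fact p.Prime] (_hpm : p.Coprime m), (p : ZMod m) = -1 →
      ∀ (𝔭 : Ideal (𝓞 F)) [𝔭.IsPrime] [𝔭.LiesOver (span {(p : ℤ)})]
        (v : HeightOneSpectrum (𝓞 (maximalRealSubfield F))) [𝔭.LiesOver v.asIdeal],
        𝔭.inertiaDeg ℤ = 2 ∧ v.asIdeal.inertiaDeg ℤ = 1 ∧
          ∃ w : HeightOneSpectrum (𝓞 F),
            Ideal.map (algebraMap (𝓞 (maximalRealSubfield F)) (𝓞 F)) v.asIdeal = w.asIdeal) ∧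
    (∀ (p : ℕ) [Fact p.Prime] (_hpm : p.Coprime m), (p : ZMod m) = 1 →
      ∀ (𝔭 : Ideal (𝓞 F)) [𝔭.IsPrime] [𝔭.LiesOver (span {(p : ℤ)})]
        (v : HeightOneSpectrum (𝓞 (maximalRealSubfield F))) [𝔭.LiesOver v.asIdeal],
        𝔭.inertiaDeg ℤ = 1 ∧ (v.asIdeal.primesOver (𝓞 F)).ncard = 2) ∧
    {p : ℕ | p.Prime ∧ (p : ZMod m) = -1}.Infinite ∧ {p : ℕ | p.Prime ∧ (p : ZMod m) = 1}.Infinite := by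
  haveI := isCMField_of_neg_one_notMem m L F hF
  refine ⟨fun p _ hpm h 𝔭 _ _ v _ => ?_, fun p _ hpm h 𝔭 _ _ v _ => ?_,
    infinite_setOf_prime_eq_neg_one_mod m, infinite_setOf_prime_eq_one_mod m⟩
  · exact exists_map_eq_of_eq_neg_one_mod m L F p hpm 𝔭 v h
  · exact inertiaDeg_eq_one_of_eq_one_mod m L F p hpm 𝔭 v h

end Summit.Ventures.HodgeRepro2.T5CyclotomicSubfieldSexticSummary
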